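import Literature.Claims.NS.Bachani2026
import Literature.Analysis.FluidPDE.TaoSpeedContinuation
import Literature.Analysis.FluidPDE.CheskidovShvydkoyRegularProofs
import Literature.Analysis.FluidPDE.TaoY6WhitneySum
import Literature.Analysis.FluidPDE.BKMClassPointwiseBlowup
import Literature.Analysis.FluidPDE.ClassicalSolutionGlue
import HarnessLib

/-!
# Solo salvage for claim C147 `Bachani2026` (cell `ns-claims`, D-0090): Lemma 5.1 stage (1) — «by BKM,
# blow-up implies unbounded vorticity» — for `ν > 0`

Claim C147: skeleton `Literature.Claims.NS.Bachani2026` (ADJUDICATED #133, head untouched here). Its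
`Step_L51s1` (Lemma 5.1 stage (1) p.6 l.9–10, «by BKM, blowup implies ∫‖ω‖_∞ dt = ∞, so there exist times
tₙ → T* with ‖ω(·,tₙ)‖_∞ → ∞») asks: along every blowing-up solution of the class (`BlowsUp ν u₀ T u p`: a
classical solution on `[0,T)`, finite energy, smooth `H¹` datum, NO classical continuation past `T`), the
vorticity is unbounded on `[0,T) × ℝ³`. The typed class carries no Sobolev bounds at `t = 0` (datum only
`H¹ ∩ C^∞`), which is why the SALVAGE of record (salvage-p2) rated the glue «L». This file proves the step for
EVERY `ν > 0` (`step_L51s1_of_pos`): away from `t = 0` the class solution is a Beale–Kato–Majda-class solution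
(Tao 2013, Cor. 11.1 in the tree: `hasBoundedSobolevNormsOn_pos_of_finiteEnergy` with the PROVED
`tao2011_H1_local_almost_regular_holds` / `tao2011_enstrophyLocalisation_exterior_apriori_holds`); a smooth
continuation of the translate `u(· + σ)` past `T − σ` would continue `u` past `T`
(`HasSmoothExtensionPast.of_translate`), so the translate has none, and the tree's BKM-class pointwise blow-up
`exists_gt_norm_curl_of_not_hasSmoothExtensionPast` (Beale–Kato–Majda 1984, Thm 1) yields vorticity values above
any bound. The typed step quantifies over every real `ν` with no positivity in the class; the `ν ≤ 0` residue has
no kernel route here and is left open — records-grade, not a discharge of `Step_L51s1`. Salvage seat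
`ns-claims-salvage-p1` g4 (cross-row TRUE column, announce-first 16:03Z).

WHAT THIS IS NOT: not a claim about NS regularity or blow-up; not a claim about any author beyond the typed
locator.
-/

set_option linter.dupNamespace false

noncomputable section

open Set Filter MeasureTheory Topology
open scoped ENNReal NNReal ContDiff

namespace Summit.NavierStokesRegularity.NavierStokesRegularity.Theorems.Bachani2026BKM

open Literature.Analysis.FluidPDE
open Literature.Claims.NS.Bachani2026 (E3 IsSol IsDatum BlowsUp Step_L51s1)

variable {ν T : ℝ} {u₀ : E3 → E3} {u : ℝ → E3 → E3} {p : ℝ → E3 → ℝ}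

/-- **Interior Sobolev regularity of a class solution** (Tao 2013, Cor. 11.1): for `0 < σ < T' < T` all `L²`
Sobolev norms of `u` are bounded on `[σ, T']`. [cite: Tao2011, Cor. 11.1] -/
theorem hasBoundedSobolevNormsOn_interior (hν : 0 < ν) (hsol : IsSol ν u₀ T u p) {σ T' : ℝ} (hσ : 0 < σ)
    (hσT' : σ < T') (hT' : T' < T) : HasBoundedSobolevNormsOn (Icc σ T') u := by
  have hT'0 : 0 < T' := hσ.trans hσT'
  have hcl : IsClassicalNSSolutionOn (Icc 0 T') ν 0 u p :=
    hsol.classical.mono (Icc_subset_Ico_right hT') (uniqueDiffOn_Icc hT'0)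
  have hfe : ∃ C : ℝ≥0∞, C < ⊤ ∧ ∀ t ∈ Icc 0 T', ∫⁻ x, ‖u t x‖ₑ ^ 2 ≤ C := by
    obtain ⟨A, hA, hAt⟩ := hsol.energy
    exact ⟨A, hA, fun t ht => hAt t ⟨ht.1, ht.2.trans_lt hT'⟩⟩
  obtain ⟨c, hc, hreg⟩ := tao2011_H1_local_almost_regular_holds
  exact hasBoundedSobolevNormsOn_pos_of_finiteEnergy hc hreg tao2011_enstrophyLocalisation_exterior_apriori_holds
    hν hT'0 hcl hfe hσ hσT'

/-- **The translate `u(· + σ)` is a Beale–Kato–Majda-class solution on `[0, T − σ)`**: classical, with all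
`L²` Sobolev norms bounded on every closed sub-slab. [cite: Tao2011, Cor. 11.1] -/
theorem translate_bkmClass (hν : 0 < ν) (hsol : IsSol ν u₀ T u p) {σ : ℝ} (hσ : 0 < σ) (hσT : σ < T) :
    IsClassicalNSSolutionOn (Ico 0 (T - σ)) ν 0 (fun s => u (s + σ)) (fun s => p (s + σ)) ∧
      ∀ T'' < T - σ, HasBoundedSobolevNormsOn (Icc 0 T'') (fun s => u (s + σ)) := by
  refine ⟨(hsol.classical.comp_add_right σ).mono (fun s hs => ?_) (uniqueDiffOn_Ico 0 (T - σ)), ?_⟩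
  · exact ⟨by linarith [hs.1], by linarith [hs.2]⟩
  · intro T'' hT''
    rcases lt_or_ge T'' 0 with hneg | hnn
    · exact fun n => ⟨0, fun t ht => absurd (ht.1.trans ht.2) (not_le.2 hneg)⟩
    · -- bounds of `u` on `[σ, σ + T'' + (gap)/2]`
      set T' : ℝ := σ + T'' + (T - σ - T'') / 2 with hT'
      have hB := hasBoundedSobolevNormsOn_interior hν hsol hσ (T' := T') (by rw [hT']; linarith)
        (by rw [hT']; linarith)
      intro n
      obtain ⟨C, hC⟩ := hB n
      exact ⟨C, fun s hs => hC (s + σ) ⟨by linarith [hs.1], by rw [hT']; linarith [hs.2]⟩⟩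

/-- **`Step_L51s1` for `ν > 0`** (Lemma 5.1 stage (1) p.6 l.9–10): along a blowing-up solution of the class the
vorticity exceeds every bound somewhere on `[0,T) × ℝ³` (Beale–Kato–Majda in the finite-energy class, no Sobolev
bounds at `t = 0` assumed). [cite: Bachani2026, Lemma 5.1 (1) p.6 l.9–10; §1.2 p.2 l.12–13]
[cite: BealeKatoMajda1984, Thm. 1] -/
theorem step_L51s1_of_pos (hν : 0 < ν) (hB : BlowsUp ν u₀ T u p) (M : ℝ) :
    ∃ t ∈ Ico 0 T, ∃ x : E3, M < ‖curl (u t) x‖ := by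
  obtain ⟨hT, hsol, hmax⟩ := hB
  set σ : ℝ := T / 2 with hσ
  have hσ0 : 0 < σ := by rw [hσ]; linarith
  have hσT : σ < T := by rw [hσ]; linarith
  obtain ⟨hcl, hreg⟩ := translate_bkmClass hν hsol hσ0 hσT
  -- no smooth continuation of the translate past `T - σ`
  have hmax' : ¬ HasSmoothExtensionPast ν 0 (fun s => u (s + σ)) (T - σ) := by
    intro hext
    refine hmax (HasSmoothExtensionPast.of_translate hsol.classical hσ0 hσT ?_)
    exact hext
  obtain ⟨t, ht, x, hx⟩ := exists_gt_norm_curl_of_not_hasSmoothExtensionPast hν.le (by linarith) hcl hreg hmax'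
    M (t₀ := 0) ⟨le_rfl, by linarith⟩
  exact ⟨t + σ, ⟨by linarith [ht.1], by linarith [ht.2]⟩, x, hx⟩

/-- The `ν > 0` half of the typed step, in its own shape. [cite: Bachani2026, Lemma 5.1 (1) p.6 l.9–10] -/
theorem step_L51s1_pos_part :
    ∀ (ν : ℝ) (u₀ : E3 → E3) (T : ℝ) (u : ℝ → E3 → E3) (p : ℝ → E3 → ℝ), 0 < ν → BlowsUp ν u₀ T u p →
      ∀ M : ℝ, ∃ t ∈ Ico 0 T, ∃ x : E3, M < ‖curl (u t) x‖ :=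
  fun _ _ _ _ _ hν hB M => step_L51s1_of_pos hν hB M

end Summit.NavierStokesRegularity.NavierStokesRegularity.Theorems.Bachani2026BKM

end
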